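import Mathlib.MeasureTheory.Measure.Tilted
import Mathlib.Probability.Moments.Variance
import Mathlib.Topology.Order.Compact
import Literature.Probability.LatticeModels.GibbsSpecificationDLRProofs
import HarnessLib

/-!
# Venture YMGap, track ROBUST-BALL — loop screening I: response of a Gibbs mean to a source;
# a variance floor from one DLR kernel

HONEST FRAMING. WHAT THIS IS: a venture file (cell `pub-ymgap`, track Y2, seat lit-1 g5), the
abstract measure-theoretic half of the tier-2 area-law NO-GO (`RobustBall/AreaLawTierTwoNoGo.lean`):
two elementary facts about tilted probability measures. WHAT IT IS NOT: nothing gauge-theoretic yet,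
no number of the cell, nothing about the continuum.

* `integral_tilted_sub_integral_ge` / `exists_sign_abs_integral_tilted_ge` — for a probability
  measure `μ` and a measurable `X` with `|X| ≤ M`, `s ≥ 0`:
  `∫ X d(μ.tilted (sX)) - ∫ X dμ ≥ s e^{-2sM} Var_μ(X)` (and the mirror statement for `-s`), hence
  for `σ = 1` or `σ = -1`, `|∫ X d(μ.tilted (σ s X))| ≥ s e^{-2sM} Var_μ(X)`. This is the
  derivative-free form of `d⟨X⟩_s/ds = Var_s(X) ≥ 0`: `⟨X⟩_s - ⟨X⟩_0 = Cov_μ(X, e^{sX}) / Z_s`,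
  `(X - m)(e^{sX} - e^{sm}) ≥ s e^{-sM} (X - m)²` pointwise (`mul_exp_sub_exp_ge`), `Z_s ≤ e^{sM}`.
* `exp_neg_mul_integral_sq_le_integral_tilted` — a tilt by an energy taking values in an interval
  of length `D` costs at most `e^{-D}` on `∫ (X - c)²`;
  `integral_sq_sub_integral_le` — the mean minimises `c ↦ ∫ (X - c)²`;
  `le_integral_sq_sub_of_isGibbsMeasure` — **law of total variance through a DLR kernel**: if every
  kernel `γ_Λ(· | η)` of a specification spreads `X` by `≥ v` around every constant, every Gibbs
  measure has `Var(X) ≥ v` (tree `IsGibbsMeasure.integral_integral_eq`).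

Everything is proved; no definition, no named fact. [folklore]
-/

noncomputable section

open MeasureTheory ProbabilityTheory Real Finset
open Literature.Probability.LatticeModels

namespace Summit.Ventures.YMGap.RobustBall

namespace LoopScreening

/-! ### Part A — response of a Gibbs mean to a source term (tilt monotonicity, quantitative) -/

section Tilt

variable {Ω : Type*} [MeasurableSpace Ω] {X : Ω → ℝ} {M : ℝ}
/-- A continuous function of a bounded measurable observable is integrable for a finite measure. [folklore] -/
theorem integrable_comp_of_abs_le {μ : Measure Ω} [IsFiniteMeasure μ] (hX : Measurable X)
    (hM : ∀ ω, |X ω| ≤ M) {f : ℝ → ℝ} (hf : Continuous f) : Integrable (fun ω => f (X ω)) μ := by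
  obtain ⟨C, hC⟩ := (isCompact_Icc (a := -M) (b := M)).exists_bound_of_continuousOn hf.continuousOn
  refine Integrable.of_bound (hf.measurable.comp hX).aestronglyMeasurable C (ae_of_all _ fun ω => ?_)
  exact hC _ (Set.mem_Icc.2 (abs_le.1 (hM ω)))




/-- Pointwise convexity input: for `0 ≤ s` and `|a|, |b| ≤ M`,
`(a - b) (e^{s a} - e^{s b}) ≥ s e^{-s M} (a - b)²` (mean value / `1 + x ≤ eˣ`). [folklore] -/
theorem mul_exp_sub_exp_ge {s M a b : ℝ} (hs : 0 ≤ s) (ha : |a| ≤ M) (hb : |b| ≤ M) :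
    s * exp (-(s * M)) * (a - b) ^ 2 ≤ (a - b) * (exp (s * a) - exp (s * b)) := by
  have key : ∀ {a b : ℝ}, |b| ≤ M → b ≤ a →
      s * exp (-(s * M)) * (a - b) ^ 2 ≤ (a - b) * (exp (s * a) - exp (s * b)) := by
    intro a b hb hab
    have hbM : -(s * M) ≤ s * b := by
      have := (abs_le.1 hb).1
      nlinarith
    have h1 : exp (s * b) * (s * (a - b)) ≤ exp (s * a) - exp (s * b) := by
      have h := Real.add_one_le_exp (s * (a - b))
      have : exp (s * a) = exp (s * b) * exp (s * (a - b)) := by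
        rw [← Real.exp_add]; ring_nf
      rw [this]
      nlinarith [Real.exp_pos (s * b)]
    have h2 : exp (-(s * M)) * (s * (a - b)) ≤ exp (s * b) * (s * (a - b)) :=
      mul_le_mul_of_nonneg_right (Real.exp_le_exp.2 hbM) (by nlinarith)
    have hab' : 0 ≤ a - b := sub_nonneg.2 hab
    calc s * exp (-(s * M)) * (a - b) ^ 2 = (a - b) * (exp (-(s * M)) * (s * (a - b))) := by ring
      _ ≤ (a - b) * (exp (s * b) * (s * (a - b))) := mul_le_mul_of_nonneg_left h2 hab'
      _ ≤ (a - b) * (exp (s * a) - exp (s * b)) := mul_le_mul_of_nonneg_left h1 hab'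
  rcases le_total b a with hab | hab
  · exact key hb hab
  · have := key ha hab
    calc s * exp (-(s * M)) * (a - b) ^ 2 = s * exp (-(s * M)) * (b - a) ^ 2 := by ring
      _ ≤ (b - a) * (exp (s * b) - exp (s * a)) := this
      _ = (a - b) * (exp (s * a) - exp (s * b)) := by ring

variable {μ : Measure Ω} [IsProbabilityMeasure μ]

/-- The mean of an observable bounded by `M` is bounded by `M`. [folklore] -/
theorem abs_integral_le_of_abs_le (hM : ∀ ω, |X ω| ≤ M) : |∫ ω, X ω ∂μ| ≤ M := by
  obtain ⟨ω₀⟩ := nonempty_of_isProbabilityMeasure μ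
  have hM0' : 0 ≤ M := (abs_nonneg _).trans (hM ω₀)
  have hM0 : 0 ≤ M * (μ Set.univ).toReal := by positivity
  calc |∫ ω, X ω ∂μ| ≤ ∫ ω, |X ω| ∂μ := abs_integral_le_integral_abs
    _ ≤ ∫ _, M ∂μ := by
        by_cases hi : Integrable (fun ω => |X ω|) μ
        · exact integral_mono hi (integrable_const M) hM
        · rw [integral_undef hi, integral_const]; simpa using hM0
    _ = M := by simp

/-- **Response of the mean to a source, lower bound.** For a probability measure `μ`, a measurable
observable `X` with `|X| ≤ M` and `s ≥ 0`, tilting `μ` by `e^{s X}` raises the mean of `X` by at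
least `s e^{-2 s M} Var_μ(X)`:
`∫ X d(μ.tilted (s X)) - ∫ X dμ ≥ s e^{-2sM} ∫ (X - ∫ X dμ)² dμ`
(`d/ds ⟨X⟩_s = Var_s(X) ≥ 0`, made derivative-free: `⟨X⟩_s - ⟨X⟩_0 = Cov_μ(X, e^{sX}) / Z_s` with
`Cov_μ(X, e^{sX}) = ∫ (X - m)(e^{sX} - e^{sm}) dμ ≥ s e^{-sM} Var_μ(X)` pointwise and
`Z_s ≤ e^{sM}`). [folklore] -/
theorem integral_tilted_sub_integral_ge (hX : Measurable X) (hM : ∀ ω, |X ω| ≤ M) {s : ℝ}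
    (hs : 0 ≤ s) :
    s * exp (-(2 * s * M)) * ∫ ω, (X ω - ∫ ω', X ω' ∂μ) ^ 2 ∂μ ≤
      ∫ ω, X ω ∂(μ.tilted fun ω => s * X ω) - ∫ ω, X ω ∂μ := by
  set m : ℝ := ∫ ω', X ω' ∂μ with hm
  have hmM : |m| ≤ M := abs_integral_le_of_abs_le hM
  -- integrability of the composite observables
  have hi_exp : Integrable (fun ω => exp (s * X ω)) μ :=
    integrable_comp_of_abs_le hX hM (f := fun x => exp (s * x)) (by fun_prop)
  have hi_expX : Integrable (fun ω => exp (s * X ω) * X ω) μ :=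
    integrable_comp_of_abs_le hX hM (f := fun x => exp (s * x) * x) (by fun_prop)
  have hi_sq : Integrable (fun ω => (X ω - m) ^ 2) μ :=
    integrable_comp_of_abs_le hX hM (f := fun x => (x - m) ^ 2) (by fun_prop)
  have hi_cov : Integrable (fun ω => (X ω - m) * (exp (s * X ω) - exp (s * m))) μ :=
    integrable_comp_of_abs_le hX hM (f := fun x => (x - m) * (exp (s * x) - exp (s * m)))
      (by fun_prop)
  have hi_X : Integrable X μ := integrable_comp_of_abs_le hX hM (f := fun x => x) continuous_id
  -- the normaliser
  set Z : ℝ := ∫ ω, exp (s * X ω) ∂μ with hZ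
  have hZpos : 0 < Z := integral_exp_pos hi_exp
  have hZle : Z ≤ exp (s * M) := by
    calc Z ≤ ∫ _, exp (s * M) ∂μ := integral_mono hi_exp (integrable_const _) fun ω => by
          exact Real.exp_le_exp.2 (mul_le_mul_of_nonneg_left (le_of_abs_le (hM ω)) hs)
      _ = exp (s * M) := by simp
  -- the tilted mean
  have htilt : ∫ ω, X ω ∂(μ.tilted fun ω => s * X ω) = (∫ ω, exp (s * X ω) * X ω ∂μ) / Z := by
    rw [integral_tilted]
    simp_rw [smul_eq_mul, ← hZ]
    rw [← integral_div]
    refine integral_congr_ae (ae_of_all _ fun ω => ?_)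
    ring
  -- the covariance identity
  have hcov : (∫ ω, exp (s * X ω) * X ω ∂μ) - m * Z =
      ∫ ω, (X ω - m) * (exp (s * X ω) - exp (s * m)) ∂μ := by
    have h1 : ∫ ω, (X ω - m) * (exp (s * X ω) - exp (s * m)) ∂μ =
        ∫ ω, (exp (s * X ω) * X ω - m * exp (s * X ω) - exp (s * m) * (X ω - m)) ∂μ :=
      integral_congr_ae (ae_of_all _ fun ω => by ring)
    have h2 : ∫ ω, (exp (s * X ω) * X ω - m * exp (s * X ω) - exp (s * m) * (X ω - m)) ∂μ =
        (∫ ω, exp (s * X ω) * X ω ∂μ) - m * (∫ ω, exp (s * X ω) ∂μ) -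
          exp (s * m) * ((∫ ω, X ω ∂μ) - m) := by
      have ha : Integrable (fun ω => exp (s * X ω) * X ω - m * exp (s * X ω)) μ :=
        hi_expX.sub (hi_exp.const_mul m)
      have hb : Integrable (fun ω => exp (s * m) * (X ω - m)) μ :=
        (hi_X.sub (integrable_const m)).const_mul _
      rw [integral_sub ha hb, integral_sub hi_expX (hi_exp.const_mul m), integral_const_mul,
        integral_const_mul, integral_sub hi_X (integrable_const m)]
      simp
    rw [h1, h2, ← hm, ← hZ, sub_self, mul_zero, sub_zero]
  -- pointwise lower bound, integrated
  have hlow : s * exp (-(s * M)) * ∫ ω, (X ω - m) ^ 2 ∂μ ≤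
      ∫ ω, (X ω - m) * (exp (s * X ω) - exp (s * m)) ∂μ := by
    rw [← integral_const_mul]
    exact integral_mono (hi_sq.const_mul _) hi_cov fun ω => mul_exp_sub_exp_ge hs (hM ω) hmM
  have hV0 : 0 ≤ ∫ ω, (X ω - m) ^ 2 ∂μ := integral_nonneg fun ω => sq_nonneg _
  -- assemble
  rw [htilt]
  have hstep : (∫ ω, exp (s * X ω) * X ω ∂μ) / Z - m =
      (∫ ω, (X ω - m) * (exp (s * X ω) - exp (s * m)) ∂μ) / Z := by
    rw [← hcov]; field_simp
  rw [hstep]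
  calc s * exp (-(2 * s * M)) * ∫ ω, (X ω - m) ^ 2 ∂μ
      = (s * exp (-(s * M)) * ∫ ω, (X ω - m) ^ 2 ∂μ) / exp (s * M) := by
        rw [eq_div_iff (Real.exp_pos _).ne', show -(2 * s * M) = -(s * M) + -(s * M) by ring,
          Real.exp_add]
        have : exp (-(s * M)) * exp (s * M) = 1 := by rw [← Real.exp_add]; simp
        calc s * (exp (-(s * M)) * exp (-(s * M))) * (∫ ω, (X ω - m) ^ 2 ∂μ) * exp (s * M)
            = s * exp (-(s * M)) * (∫ ω, (X ω - m) ^ 2 ∂μ) * (exp (-(s * M)) * exp (s * M)) := by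
              ring
          _ = s * exp (-(s * M)) * ∫ ω, (X ω - m) ^ 2 ∂μ := by rw [this, mul_one]
    _ ≤ (s * exp (-(s * M)) * ∫ ω, (X ω - m) ^ 2 ∂μ) / Z :=
        div_le_div_of_nonneg_left (by positivity) hZpos hZle
    _ ≤ (∫ ω, (X ω - m) * (exp (s * X ω) - exp (s * m)) ∂μ) / Z :=
        div_le_div_of_nonneg_right hlow hZpos.le

/-- The same bound for a source of the opposite sign: tilting by `e^{-sX}` LOWERS the mean by at
least `s e^{-2sM} Var_μ(X)`. [folklore] -/
theorem integral_sub_integral_tilted_neg_ge (hX : Measurable X) (hM : ∀ ω, |X ω| ≤ M) {s : ℝ}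
    (hs : 0 ≤ s) :
    s * exp (-(2 * s * M)) * ∫ ω, (X ω - ∫ ω', X ω' ∂μ) ^ 2 ∂μ ≤
      ∫ ω, X ω ∂μ - ∫ ω, X ω ∂(μ.tilted fun ω => -(s * X ω)) := by
  have h := integral_tilted_sub_integral_ge (μ := μ) (X := fun ω => -X ω) (M := M) hX.neg
    (fun ω => by rw [abs_neg]; exact hM ω) hs
  have hvar : ∫ ω, (-X ω - ∫ ω', -X ω' ∂μ) ^ 2 ∂μ = ∫ ω, (X ω - ∫ ω', X ω' ∂μ) ^ 2 ∂μ := by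
    rw [integral_neg]
    exact integral_congr_ae (ae_of_all _ fun ω => by ring)
  rw [hvar] at h
  have htilt : (μ.tilted fun ω => s * -X ω) = μ.tilted fun ω => -(s * X ω) := by
    congr 1; funext ω; ring
  rw [htilt, integral_neg, integral_neg] at h
  linarith

/-- **Two-sided form.** The means of `X` under the tilts by `e^{+sX}` and `e^{-sX}` differ by at
least `2 s e^{-2sM} Var_μ(X)`; hence at least one of them is at least `s e^{-2sM} Var_μ(X)` in
absolute value. [folklore] -/
theorem exists_sign_abs_integral_tilted_ge (hX : Measurable X) (hM : ∀ ω, |X ω| ≤ M) {s : ℝ}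
    (hs : 0 ≤ s) :
    ∃ σ : ℝ, (σ = 1 ∨ σ = -1) ∧
      s * exp (-(2 * s * M)) * ∫ ω, (X ω - ∫ ω', X ω' ∂μ) ^ 2 ∂μ ≤
        |∫ ω, X ω ∂(μ.tilted fun ω => σ * (s * X ω))| := by
  have h₁ := integral_tilted_sub_integral_ge (μ := μ) hX hM hs
  have h₂ := integral_sub_integral_tilted_neg_ge (μ := μ) hX hM hs
  set V := s * exp (-(2 * s * M)) * ∫ ω, (X ω - ∫ ω', X ω' ∂μ) ^ 2 ∂μ
  set A := ∫ ω, X ω ∂(μ.tilted fun ω => s * X ω)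
  set B := ∫ ω, X ω ∂(μ.tilted fun ω => -(s * X ω))
  by_cases hA : V ≤ |A|
  · refine ⟨1, Or.inl rfl, ?_⟩
    simpa [one_mul] using hA
  · refine ⟨-1, Or.inr rfl, ?_⟩
    have hAB : 2 * V ≤ A - B := by linarith
    have : V ≤ |B| := by
      rw [not_le] at hA
      have hA' : A < V := lt_of_abs_lt hA
      have : V ≤ -B := by linarith
      exact this.trans (neg_le_abs B)
    simpa [neg_mul, one_mul] using this


end Tilt

/-! ### Part B — a variance floor from one DLR kernel -/

section Floor

variable {Ω : Type*} [MeasurableSpace Ω] {X : Ω → ℝ} {M : ℝ}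

/-- **The mean minimises the mean square deviation**: for a probability measure and any constant
`c`, `∫ (X - ∫ X)² ≤ ∫ (X - c)²`. [folklore] -/
theorem integral_sq_sub_integral_le {ν : Measure Ω} [IsProbabilityMeasure ν] (hX : Measurable X)
    (hM : ∀ ω, |X ω| ≤ M) (c : ℝ) :
    ∫ ω, (X ω - ∫ ω', X ω' ∂ν) ^ 2 ∂ν ≤ ∫ ω, (X ω - c) ^ 2 ∂ν := by
  set m := ∫ ω', X ω' ∂ν with hm
  have hi_X : Integrable X ν := integrable_comp_of_abs_le hX hM (f := fun x => x) continuous_id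
  have hi1 : Integrable (fun ω => (X ω - m) ^ 2) ν :=
    integrable_comp_of_abs_le hX hM (f := fun x => (x - m) ^ 2) (by fun_prop)
  have hi2 : Integrable (fun ω => 2 * (m - c) * (X ω - m) + (m - c) ^ 2) ν :=
    ((hi_X.sub (integrable_const m)).const_mul _).add (integrable_const _)
  have hsplit : ∫ ω, (X ω - c) ^ 2 ∂ν =
      ∫ ω, (X ω - m) ^ 2 ∂ν + ∫ ω, (2 * (m - c) * (X ω - m) + (m - c) ^ 2) ∂ν := by
    rw [← integral_add hi1 hi2]
    exact integral_congr_ae (ae_of_all _ fun ω => by ring)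
  have hlin : ∫ ω, (2 * (m - c) * (X ω - m) + (m - c) ^ 2) ∂ν = (m - c) ^ 2 := by
    have ha : Integrable (fun ω => 2 * (m - c) * (X ω - m)) ν :=
      (hi_X.sub (integrable_const m)).const_mul _
    have hb : Integrable (fun ω => X ω - m) ν := hi_X.sub (integrable_const m)
    rw [integral_add ha (integrable_const _), integral_const_mul, integral_sub hi_X (integrable_const m),
      integral_const, integral_const]
    simp [hm]
  rw [hsplit, hlin]
  nlinarith [sq_nonneg (m - c)]

/-- **Tilting by an energy of oscillation `≤ D` costs at most a factor `e^{-D}` on nonnegative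
integrals**: if `a ≤ φ ≤ a + D` a.e., then `e^{-D} ∫ (X - c)² dν ≤ ∫ (X - c)² d(ν.tilted φ)`
(the density `e^{φ} / ∫ e^{φ}` is at least `e^{a} / e^{a + D}`). [folklore] -/
theorem exp_neg_mul_integral_sq_le_integral_tilted {ν : Measure Ω} [IsProbabilityMeasure ν]
    (hX : Measurable X) (hM : ∀ ω, |X ω| ≤ M) {φ : Ω → ℝ} (hφm : Measurable φ) {a D : ℝ}
    (hφ : ∀ᵐ ω ∂ν, a ≤ φ ω ∧ φ ω ≤ a + D) (c : ℝ) :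
    exp (-D) * ∫ ω, (X ω - c) ^ 2 ∂ν ≤ ∫ ω, (X ω - c) ^ 2 ∂(ν.tilted φ) := by
  have hi_sq : Integrable (fun ω => (X ω - c) ^ 2) ν :=
    integrable_comp_of_abs_le hX hM (f := fun x => (x - c) ^ 2) (by fun_prop)
  have hi_exp : Integrable (fun ω => exp (φ ω)) ν := by
    refine Integrable.of_bound hφm.exp.aestronglyMeasurable (exp (a + D)) ?_
    filter_upwards [hφ] with ω hω
    rw [Real.norm_eq_abs, Real.abs_exp]
    exact Real.exp_le_exp.2 hω.2
  set Z : ℝ := ∫ ω, exp (φ ω) ∂ν with hZ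
  have hZpos : 0 < Z := integral_exp_pos hi_exp
  have hZle : Z ≤ exp (a + D) := by
    calc Z ≤ ∫ _, exp (a + D) ∂ν := integral_mono_ae hi_exp (integrable_const _) (by
          filter_upwards [hφ] with ω hω using Real.exp_le_exp.2 hω.2)
      _ = exp (a + D) := by simp
  -- density lower bound a.e.
  have hdens : ∀ᵐ ω ∂ν, exp (-D) ≤ exp (φ ω) / Z := by
    filter_upwards [hφ] with ω hω
    rw [le_div_iff₀ hZpos]
    calc exp (-D) * Z ≤ exp (-D) * exp (a + D) := mul_le_mul_of_nonneg_left hZle (Real.exp_nonneg _)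
      _ = exp a := by rw [← Real.exp_add]; ring_nf
      _ ≤ exp (φ ω) := Real.exp_le_exp.2 hω.1
  -- the tilted integral
  rw [integral_tilted]
  simp_rw [smul_eq_mul, ← hZ]
  have hi_rhs : Integrable (fun ω => exp (φ ω) / Z * (X ω - c) ^ 2) ν := by
    obtain ⟨C, hC⟩ : ∃ C, ∀ ω, |(X ω - c) ^ 2| ≤ C := by
      obtain ⟨C, hC⟩ := (isCompact_Icc (a := -M) (b := M)).exists_bound_of_continuousOn
        ((continuous_id.sub continuous_const).pow 2).continuousOn
      exact ⟨C, fun ω => by simpa using hC (X ω) (Set.mem_Icc.2 (abs_le.1 (hM ω)))⟩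
    refine Integrable.of_bound ((hφm.exp.div_const Z).mul ((hX.sub_const c).pow_const 2)).aestronglyMeasurable
      (exp (a + D) / Z * C) ?_
    filter_upwards [hφ] with ω hω
    rw [Real.norm_eq_abs, abs_mul, abs_div, Real.abs_exp, abs_of_pos hZpos]
    exact mul_le_mul (div_le_div_of_nonneg_right (Real.exp_le_exp.2 hω.2) hZpos.le) (hC ω)
      (abs_nonneg _) (by positivity)
  rw [← integral_const_mul]
  exact integral_mono_ae (hi_sq.const_mul _) hi_rhs (by
    filter_upwards [hdens] with ω hω using mul_le_mul_of_nonneg_right hω (sq_nonneg _))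

/-- **A variance floor from the DLR kernels.** If `μ` is a Gibbs measure for the specification
`γ` and for every boundary condition the kernel `γ_Λ(· | η)` spreads `X` by at least `v` around
any constant (`v ≤ ∫ (X - c)² dγ_Λ(·|η)` for all `η, c`), then `Var_μ(X) ≥ v`
(law of total variance: `Var_μ X = ∫ (X - μ X)² dμ = ∫ γ_Λ((X - μX)² | η) dμ(η) ≥ v`). [folklore] -/
theorem le_integral_sq_sub_of_isGibbsMeasure {V S : Type*} [MeasurableSpace S]
    {γ : Specification V S} (hγ : IsSpecification γ) {μ : Measure (V → S)}
    (hμ : IsGibbsMeasure γ μ) (Λ : Finset V) {X : (V → S) → ℝ} (hX : Measurable X) {M : ℝ}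
    (hM : ∀ σ, |X σ| ≤ M) {v : ℝ} (hv : ∀ η (c : ℝ), v ≤ ∫ σ, (X σ - c) ^ 2 ∂(γ Λ η)) :
    v ≤ ∫ σ, (X σ - ∫ σ', X σ' ∂μ) ^ 2 ∂μ := by
  haveI := hμ.isProbabilityMeasure
  set m := ∫ σ', X σ' ∂μ
  have hi : Integrable (fun σ => (X σ - m) ^ 2) μ :=
    integrable_comp_of_abs_le hX hM (f := fun x => (x - m) ^ 2) (by fun_prop)
  rw [← hμ.integral_integral_eq hγ Λ hi]
  calc v = ∫ _, v ∂μ := by simp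
    _ ≤ ∫ η, ∫ σ, (X σ - m) ^ 2 ∂(γ Λ η) ∂μ := by
        refine integral_mono (integrable_const v) ?_ fun η => hv η m
        -- the inner integral is bounded by the bound of the integrand, hence integrable
        obtain ⟨C, hC⟩ : ∃ C, ∀ σ, |(X σ - m) ^ 2| ≤ C := by
          obtain ⟨C, hC⟩ := (isCompact_Icc (a := -M) (b := M)).exists_bound_of_continuousOn
            ((continuous_id.sub continuous_const).pow 2).continuousOn
          exact ⟨C, fun σ => by simpa using hC (X σ) (Set.mem_Icc.2 (abs_le.1 (hM σ)))⟩
        have hsm : StronglyMeasurable fun η => ∫ σ, (X σ - m) ^ 2 ∂(γ Λ η) := by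
          have hk : Measurable (γ Λ) := hγ.measurable_fun Λ
          let κ : ProbabilityTheory.Kernel (V → S) (V → S) := ⟨γ Λ, hk⟩
          have := ((hX.sub_const m).pow_const 2).stronglyMeasurable.integral_kernel (κ := κ)
          exact this
        refine Integrable.of_bound hsm.aestronglyMeasurable C (ae_of_all _ fun η => ?_)
        haveI := hγ.isProbability Λ η
        rw [Real.norm_eq_abs, abs_of_nonneg (integral_nonneg fun σ => sq_nonneg _)]
        calc ∫ σ, (X σ - m) ^ 2 ∂(γ Λ η) ≤ ∫ _, C ∂(γ Λ η) := by
              refine integral_mono_of_nonneg (ae_of_all _ fun σ => sq_nonneg _) (integrable_const C)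
                (ae_of_all _ fun σ => le_of_abs_le (hC σ))
          _ = C := by simp


end Floor


end LoopScreening

end Summit.Ventures.YMGap.RobustBall
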